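import Literature.AnabelianGeometry.SemiGraphs.PSCSeparatingCoveringsOfVertexQuotients
import Literature.AnabelianGeometry.SemiGraphs.PSCSeparatingCoveringsProofs2
import Literature.AnabelianGeometry.SemiGraphs.PSCVertexKernelStabilizerProofs
import HarnessLib

/-!
# [CombGC] Prop. 1.2, proof p. 9: the UNRAMIFIED separating coverings (row F-2828) at the `Π^unr`-levels, from [IUTchI] Rmk. 1.2.3 (iv)

Mochizuki, *A combinatorial version of the Grothendieck conjecture*, Tohoku Math. J. **59** (2007)
[CombGC], proof of Proposition 1.2, author's manuscript p. 9: "under the further assumption that `G` is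
sturdy … if `v₁ ≠ v₂` …, then there exists a finite étale `Π^unr_G`-covering `G' → G` whose
restriction to the anabelioid `G_{v₂}` is trivial …, but whose restriction to the anabelioid `G_{v₁}`
is nontrivial" [cite: MochizukiCombGC2007, Prop 1.2 proof p.9]; *Inter-universal Teichmüller theory I*
[IUTchI] Rmk. 1.2.3 (iv), kurims manuscript p. 42: the vertex quotients
`M^unr-vert_G ↠ M^unr_G[v] ⊗ F_l` of a sturdy `G` are "[nontrivial!]" and "may also be applied to
finite étale `Π^unr_G`-coverings of `G`" [cite: Mochizuki2012, IUTchI Rmk 1.2.3(iv) p.42].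

PROOF-ONLY file (abc-iut cell, FACT-LIST row F-2828 `PSCDatum.UnrVerticialSeparatingCoverings`, the
`Π^unr` third of the origin-level input P12-L01 of the Prop. 1.2 sub-DAG, typed by abc-iut-w4-d081 in
`PSCSeparatingCoverings.lean`; universal closure refuted in `PSCSeparatingCoveringsNegative.lean`;
one-vertex instance form in `PSCSeparatingCoveringsSmoothProper.lean`).  Sequel of abc-iut-f-165's
`PSCSeparatingCoveringsOfVertexQuotients.lean` (the verticial third F-2826 DERIVED from the vertex
quotients of [IUTchI] Rmk. 1.2.3 (iv) at covering data).  Here: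

1. `exists_openNormal_unrAbKer_le_vertGp_le_not_le` — f-165's one-level lemma with the kernel bound
   RETAINED: the separating open normal subgroup (kernel of `M^unr_G ↠ M^unr_G[w₁] ⊗ F_l`) contains
   `E^unr_G ⊇ Ker(Π_G ↠ Π^unr_G)`, i.e. it IS a `Π^unr_G`-covering, as print says;
2. `exists_unrSeparating_of_restrictBD` — at a `Π^unr`-LEVEL `V ⊇ Ker(Π_G ↠ Π^unr_G)` the level-`V`
   clause of F-2828 from the two inputs at the covering datum `G_V`: there the `Π^unr`-vertices
   `V γ (Π_v·Ker)` ARE the vertices `V γ Π_v` (`doubleCoset_sup_eq_of_le`), "trivial over `v₂'` as a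
   `Π^unr`-covering" `(γ₂Π_{v₂}γ₂⁻¹·Ker) ∩ V ⊆ U` is `γ₂Π_{v₂}γ₂⁻¹ ∩ V ⊆ U ∧ Ker ⊆ U`
   (`sup_normal_inf_le`), and `Ker ⊆ closure([V,V]·Ker) = E^unr_{G_V} ⊆ U`;
3. `unrVerticialSeparating_unrLevels_of_sturdy` / `…_of_origin` (`'`, `_frozen`) — **F-2828
   RESTRICTED TO THE `Π^unr`-LEVELS `V ⊇ Ker`, for every sturdy datum on a profinite group whose
   covering data carry the split injection (corrected form) and the rank statement, resp. for every
   `Ω`-datum granted BY NAME `RestrictBDOfPSCTypeHolds Ω`, [IUTchI] Rmk. 1.2.3 (iv)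
   (`UnrVerticialCharacterizationHolds' Ω` or the frozen F-1938), Rmk. 1.1.5's rank statement
   (`UnrVertAbOfRankHolds Ω`) and profiniteness** — one input FEWER than the verticial case (no
   `SturdyCoverHolds`: F-2828 carries sturdiness, and every level of a sturdy datum is sturdy);
4. (companion `PSCSeparatingCoveringsUnrConsumers.lean`, 400-line rule) THE CONSUMERS RE-DERIVED
   from the restricted form: every tree consumer of F-2828 (`sameVertex_of_isOpen_unr` →
   `commensurator_unrVertGp_eq_of_separating` → `unrVerticialCommensurablyTerminal_of_separating`,
   `unrVerticialOpenInterDeterminesVertex_of_separating`, abc-iut-w5-d183) instantiates it ONLY at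
   levels `U ∩ U₁ ⊇ Ker`; so Prop. 1.2 (i) and (ii) for the unramified verticial subgroups (rows
   P12-L02-U, P12-L03-U) follow from the named inputs of 3 — the `Π^unr` third of P12-L01 is no
   longer an independent origin-level assumption of those nodes.

CENSUS (what is NOT derived).  F-2828 AS TYPED also quantifies over levels `V ⊉ Ker` (a
`Π_G`-covering that is not a `Π^unr_G`-covering, its vertices grouped by the `Π^unr`-covering
`V·Ker`), with "nontrivial over `v₁'`" measured by `γ₁Π_{v₁}γ₁⁻¹ ∩ V`; no consumer uses these levels,
and they are NOT reached by elementary abelian vertex quotients: the quotient of `G_{V·Ker}` at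
`w₁` misses some `b ∈ γ₁Π_{v₁}γ₁⁻¹ ∩ V·Ker`, but `[V·Ker : V]` is a `Σ`-number, so the available power
`b^{[V·Ker:V]} ∈ V` may die in the `l`-Frattini quotient.  The EDGE-LIKE third F-2827 is not touched
(abc-iut-f-165's census: needs the structure of `M^edge`, [CombGC] Prop. 1.3, untyped).
0 definitions; plain profinite group theory over the interface; typed ≠ proved for the inputs; a
FACT row is an assumption label; nothing here takes a side on [IUTchIII] Cor. 3.12.
-/

noncomputable section

namespace Literature.AnabelianGeometry.SemiGraphs

namespace PSCDatum

open scoped Pointwise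
open PSCCovering

universe u

variable {P : Type u} [Group P] [TopologicalSpace P] [IsTopologicalGroup P]

/-! ### 0. Two pieces of subgroup bookkeeping at a level containing a normal subgroup -/

omit [TopologicalSpace P] [IsTopologicalGroup P] in
/-- At a level `V ⊇ K` (`K` normal) the double cosets `V x (A·K)` and `V x A` coincide: the vertices of
the `Π^unr_G`-covering `G_V` over `v` (`V \ Π_G / Π_v·Ker`) are its vertices as a `Π_G`-covering
(`V \ Π_G / Π_v`). [cite: MochizukiCombGC2007, Def 1.1(ii) p.7] -/
theorem doubleCoset_sup_eq_of_le {V A K : Subgroup P} [hK : K.Normal] (hKV : K ≤ V) (x : P) :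
    DoubleCoset.doubleCoset x (V : Set P) ((A ⊔ K : Subgroup P) : Set P) =
      DoubleCoset.doubleCoset x (V : Set P) (A : Set P) := by
  ext b
  constructor
  · intro hb
    obtain ⟨u, hu, y, hy, rfl⟩ := DoubleCoset.mem_doubleCoset.mp hb
    have hy' : y ∈ ((A ⊔ K : Subgroup P) : Set P) := hy
    rw [Subgroup.mul_normal] at hy'
    obtain ⟨a, ha, k, hk, rfl⟩ := Set.mem_mul.mp hy'
    -- `u x (a k) = (u · (x a) k (x a)⁻¹) · x · a`, the conjugate of `k` lying in `K ≤ V`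
    refine DoubleCoset.mem_doubleCoset.mpr ⟨u * ((x * a) * k * (x * a)⁻¹), ?_, a, ha, by group⟩
    exact V.mul_mem hu (hKV (hK.conj_mem k hk _))
  · intro hb
    obtain ⟨u, hu, a, ha, rfl⟩ := DoubleCoset.mem_doubleCoset.mp hb
    exact DoubleCoset.mem_doubleCoset.mpr ⟨u, hu, a, Subgroup.mem_sup_left ha, rfl⟩

omit [TopologicalSpace P] [IsTopologicalGroup P] in
/-- At a level `V ⊇ K` (`K` normal): `(A·K) ∩ V ⊆ U` as soon as `A ∩ V ⊆ U` and `K ⊆ U` — "trivial over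
the vertex as a `Π^unr`-covering" is "trivial over the vertex, and unramified". [folklore] -/
private theorem sup_normal_inf_le {V A K U : Subgroup P} [K.Normal] (hKV : K ≤ V) (hA : A ⊓ V ≤ U)
    (hKU : K ≤ U) : (A ⊔ K) ⊓ V ≤ U := by
  intro x hx
  obtain ⟨hxAK, hxV⟩ := Subgroup.mem_inf.mp hx
  have hx' : x ∈ ((A ⊔ K : Subgroup P) : Set P) := hxAK
  rw [Subgroup.mul_normal] at hx'
  obtain ⟨a, ha, k, hk, rfl⟩ := Set.mem_mul.mp hx'
  have haV : a ∈ V := by simpa using V.mul_mem hxV (V.inv_mem (hKV hk))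
  exact U.mul_mem (hA (Subgroup.mem_inf.mpr ⟨ha, haV⟩)) (hKU hk)

/-! ### 1. One level, keeping the kernel: the separating subgroup is a `Π^unr`-covering -/

section Level

variable [CompactSpace P] [T2Space P]

/-- **One level, unramified form** of abc-iut-f-165's `exists_openNormal_vertGp_le_not_le` (same
construction, the kernel bound retained): for a sturdy datum on a profinite group satisfying the split
injection and the rank statement, and vertices `w₁ ≠ w₂`, the kernel `H` of the elementary abelian
quotient `M^unr_G ↠ M^unr_G[w₁] ⊗ F_l` is open normal, CONTAINS `E^unr_G` (hence `Ker(Π_G ↠ Π^unr_G)`: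
"a finite étale `Π^unr_G`-covering"), contains `Π_{w₂}` and not `Π_{w₁}`.
[cite: MochizukiCombGC2007, Prop 1.2 proof p.9] -/
theorem exists_openNormal_unrAbKer_le_vertGp_le_not_le (G : PSCDatum P)
    (hsplit : G.UnrVerticialSplitInjection) (hrank : G.UnrVertAbOfRank) (hGs : G.IsSturdy)
    {w₁ w₂ : G.graph.V} (hne : w₁ ≠ w₂) :
    ∃ H : Subgroup P, H.Normal ∧ IsOpen (H : Set P) ∧ G.unrAbKer ≤ H ∧ G.vertGp w₂ ≤ H ∧
      ¬ G.vertGp w₁ ≤ H := by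
  obtain ⟨l, hlS⟩ := G.sigma_nonempty
  have hl : l.Prime := G.sigma_prime l hlS
  obtain ⟨H, hH, -, hinf⟩ :=
    G.exists_isElemAbUnrQuotient_inf_eq_vertexQuotientKer hsplit hrank hGs hl hlS w₁
  refine ⟨H, hH.1, hH.2.1, hH.2.2.1, ?_, fun h₁ => ?_⟩
  · exact (G.vertGp_le_vertexQuotientKer l hne.symm).trans (hinf ▸ inf_le_right)
  · have hall : ∀ w, G.vertGp w ≤ H := fun w => by
      by_cases hw : w = w₁
      · exact hw ▸ h₁
      · exact (G.vertGp_le_vertexQuotientKer l hw).trans (hinf ▸ inf_le_right)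
    have hle : G.unrVertAb ≤ H := G.unrVertAb_le_of_forall_vertGp_le hH.2.1 hH.2.2.1 hall
    exact G.vertexQuotientKer_ne_unrVertAb hsplit hrank hGs hlS w₁
      (by rw [← hinf]; exact inf_eq_left.mpr hle)

end Level

/-! ### 2. The level-`V` clause of F-2828 at a `Π^unr`-level `V ⊇ Ker`, from the inputs at `G_V` -/

section Restrict

variable [CompactSpace P] [T2Space P]
variable (G : PSCDatum P) (V : Subgroup P) [V.FiniteIndex] (hV : IsOpen (V : Set P)) (bd : G.BranchData)

/-- **The level-`V` clause of `UnrVerticialSeparatingCoverings` at a `Π^unr_G`-level** (`Π_G`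
profinite, `V ⊴ Π_G` open with `V ⊇ Ker(Π_G ↠ Π^unr_G)`, any branch data): if the covering datum
`G_V` is sturdy and satisfies [IUTchI] Rmk. 1.2.3 (iv)'s split injection (corrected form) and
Rmk. 1.1.5's rank statement, then two DISTINCT vertices `(v₁, Vγ₁Π_{v₁}·Ker) ≠ (v₂, Vγ₂Π_{v₂}·Ker)` of
the `Π^unr`-covering `G_V` are separated by an open `U ≤ V`, normal in `V`, with
`(γ₂Π_{v₂}γ₂⁻¹·Ker) ∩ V ⊆ U` ("trivial over `v₂'`", a `Π^unr`-covering) and `γ₁Π_{v₁}γ₁⁻¹ ∩ V ⊄ U`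
("nontrivial over `v₁'`"). [cite: MochizukiCombGC2007, Prop 1.2 proof p.9] -/
theorem exists_unrSeparating_of_restrictBD [V.Normal] (hKV : G.unrKer ≤ V)
    (hsplit : (G.restrictBD V hV bd).UnrVerticialSplitInjection')
    (hrank : (G.restrictBD V hV bd).UnrVertAbOfRank) (hst : (G.restrictBD V hV bd).IsSturdy)
    (v₁ v₂ : G.graph.V) (γ₁ γ₂ : ConjAct P)
    (hne : v₁ ≠ v₂ ∨
      DoubleCoset.doubleCoset (ConjAct.ofConjAct γ₁) (V : Set P)
          ((G.vertGp v₁ ⊔ G.unrKer : Subgroup P) : Set P) ≠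
        DoubleCoset.doubleCoset (ConjAct.ofConjAct γ₂) (V : Set P)
          ((G.vertGp v₂ ⊔ G.unrKer : Subgroup P) : Set P)) :
    ∃ U : Subgroup P, IsOpen (U : Set P) ∧ U ≤ V ∧ (U.subgroupOf V).Normal ∧
      (γ₂ • G.vertGp v₂ ⊔ G.unrKer) ⊓ V ≤ U ∧ ¬ ((γ₁ • G.vertGp v₁) ⊓ V ≤ U) := by
  -- `V` is profinite
  have hVc : IsClosed (V : Set P) := Subgroup.isClosed_of_isOpen V hV
  haveI : CompactSpace V := isCompact_iff_compactSpace.mp hVc.isCompact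
  -- at a level containing `Ker`, the `Π^unr`-vertices are the vertices
  have hne' : v₁ ≠ v₂ ∨
      DoubleCoset.doubleCoset (ConjAct.ofConjAct γ₁) (V : Set P) (G.vertGp v₁ : Set P) ≠
        DoubleCoset.doubleCoset (ConjAct.ofConjAct γ₂) (V : Set P) (G.vertGp v₂ : Set P) := by
    rcases hne with h | h
    · exact Or.inl h
    · right
      rwa [doubleCoset_sup_eq_of_le hKV, doubleCoset_sup_eq_of_le hKV] at h
  -- the two level-`V` vertices, as vertices of the covering datum `G_V`
  set w₁ := G.vertexOver V v₁ (ConjAct.ofConjAct γ₁) with hw₁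
  set w₂ := G.vertexOver V v₂ (ConjAct.ofConjAct γ₂) with hw₂
  have hw : w₁ ≠ w₂ := by
    intro h
    obtain ⟨h1, h2⟩ := G.vertexOver_eq_imp V h
    exact hne'.elim (fun h' => h' h1) (fun h' => h' h2)
  haveI : Nontrivial (G.restrictBD V hV bd).graph.V := ⟨⟨w₁, w₂, hw⟩⟩
  obtain ⟨H, hHn, hHo, hHE, h₂, h₁⟩ :=
    (G.restrictBD V hV bd).exists_openNormal_unrAbKer_le_vertGp_le_not_le
      (UnrVerticialSplitInjection'.toOld _ hsplit) hrank hst hw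
  -- `Ker ⊆ closure([V,V]·Ker) = E^unr_{G_V} ⊆ H` (images in `Π_G`)
  have hEmap : ((G.restrictBD V hV bd).unrAbKer).map V.subtype =
      (⁅V, V⁆ ⊔ G.unrKer).topologicalClosure :=
    G.map_subtype_unrAbKer_restrict V hV hKV
  have hKH : G.unrKer ≤ H.map V.subtype :=
    calc G.unrKer ≤ (⁅V, V⁆ ⊔ G.unrKer).topologicalClosure :=
          le_sup_right.trans (Subgroup.le_topologicalClosure _)
      _ = ((G.restrictBD V hV bd).unrAbKer).map V.subtype := hEmap.symm
      _ ≤ H.map V.subtype := Subgroup.map_mono hHE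
  refine ⟨H.map V.subtype, ?_, Subgroup.map_subtype_le H, ?_, ?_, ?_⟩
  · -- open
    have e : ((H.map V.subtype : Subgroup P) : Set P) = Subtype.val '' (H : Set V) := by
      ext x; simp only [Subgroup.coe_map, Subgroup.coe_subtype, Set.mem_image, SetLike.mem_coe]
    rw [e]
    exact hV.isOpenMap_subtype_val _ hHo
  · -- normal in `V`
    rw [← Subgroup.comap_subtype, Subgroup.comap_map_eq_self_of_injective V.subtype_injective]
    exact hHn
  · -- trivial over `v₂'`, as a `Π^unr`-covering
    have h₂' : (ConjAct.toConjAct (ConjAct.ofConjAct γ₂) • G.vertGp v₂).subgroupOf V ≤ H :=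
      (G.restrictBD_vertGp_vertexOver_le_iff V hV bd hHn v₂ _).mp h₂
    rw [ConjAct.toConjAct_ofConjAct] at h₂'
    have hAV : (γ₂ • G.vertGp v₂) ⊓ V ≤ H.map V.subtype := by
      intro x hx
      obtain ⟨hxA, hxV⟩ := Subgroup.mem_inf.mp hx
      exact Subgroup.mem_map.mpr ⟨⟨x, hxV⟩, h₂' (Subgroup.mem_subgroupOf.mpr hxA), rfl⟩
    exact sup_normal_inf_le hKV hAV hKH
  · -- nontrivial over `v₁'`
    intro hle
    apply h₁
    refine (G.restrictBD_vertGp_vertexOver_le_iff V hV bd hHn v₁ _).mpr ?_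
    rw [ConjAct.toConjAct_ofConjAct]
    intro y hy
    have hyU : (y : P) ∈ H.map V.subtype :=
      hle (Subgroup.mem_inf.mpr ⟨Subgroup.mem_subgroupOf.mp hy, y.2⟩)
    obtain ⟨z, hz, hzy⟩ := Subgroup.mem_map.mp hyU
    rwa [← Subtype.ext hzy]

end Restrict

/-! ### 3. F-2828 restricted to the `Π^unr`-levels -/

section Datum

variable [CompactSpace P] [T2Space P] (G : PSCDatum P)

/-- **Row F-2828 at the `Π^unr`-levels, for a STURDY datum on a profinite group** whose covering data
`G_V` at the `Π^unr`-levels `V ⊇ Ker` (open normal; fixed branch data) satisfy the split injection and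
the rank statement: every such `V` serves as its own `V'` (every level of a sturdy datum is sturdy,
`IsSturdy.restrictBD`).  This is `UnrVerticialSeparatingCoverings` with its level quantifier restricted
to `V ⊇ Ker(Π_G ↠ Π^unr_G)` — the only levels at which the tree consumes the row.
[cite: MochizukiCombGC2007, Prop 1.2 proof p.9] -/
theorem unrVerticialSeparating_unrLevels_of_sturdy (bd : G.BranchData)
    (h : ∀ (V : Subgroup P) [V.FiniteIndex] (hV : IsOpen (V : Set P)), V.Normal → G.unrKer ≤ V →
      (G.restrictBD V hV bd).UnrVerticialSplitInjection' ∧ (G.restrictBD V hV bd).UnrVertAbOfRank) :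
    G.IsSturdy → ∀ V : Subgroup P, V.Normal → IsOpen (V : Set P) → G.unrKer ≤ V →
      ∃ V' : Subgroup P, V'.Normal ∧ IsOpen (V' : Set P) ∧ V' ≤ V ∧
        ∀ (v₁ v₂ : G.graph.V) (γ₁ γ₂ : ConjAct P),
          (v₁ ≠ v₂ ∨
            DoubleCoset.doubleCoset (ConjAct.ofConjAct γ₁) (V' : Set P)
                ((G.vertGp v₁ ⊔ G.unrKer : Subgroup P) : Set P) ≠
              DoubleCoset.doubleCoset (ConjAct.ofConjAct γ₂) (V' : Set P)
                ((G.vertGp v₂ ⊔ G.unrKer : Subgroup P) : Set P)) →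
          ∃ U : Subgroup P, IsOpen (U : Set P) ∧ U ≤ V' ∧ (U.subgroupOf V').Normal ∧
            (γ₂ • G.vertGp v₂ ⊔ G.unrKer) ⊓ V' ≤ U ∧ ¬ ((γ₁ • G.vertGp v₁) ⊓ V' ≤ U) := by
  intro hGs V hVn hVo hKV
  haveI : V.FiniteIndex := finiteIndex_of_isOpen V hVo
  obtain ⟨hsplit, hrank⟩ := h V hVo hVn hKV
  exact ⟨V, hVn, hVo, le_rfl, fun v₁ v₂ γ₁ γ₂ hne =>
    G.exists_unrSeparating_of_restrictBD V hVo bd hKV hsplit hrank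
      (IsSturdy.restrictBD G V hVo bd hGs) v₁ v₂ γ₁ γ₂ hne⟩

end Datum

/-! ### 4. Over the origin predicate -/

section Origin

variable (Ω : PSCOrigin.{u})

/-- **Row F-2828 at the `Π^unr`-levels over an origin predicate `Ω`, every input an origin statement
BY NAME**: "coverings of PSC-type data are of PSC-type" (`RestrictBDOfPSCTypeHolds Ω`), the split
injection of [IUTchI] Rmk. 1.2.3 (iv) in corrected form for every `Ω`-datum (displayed; supplied by
`UnrVerticialCharacterizationHolds' Ω`, see the primed corollary), Rmk. 1.1.5's rank statement
(`UnrVertAbOfRankHolds Ω`), and profiniteness of the `Π_G` of `Ω`-data (displayed `hprof`).  No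
`SturdyCoverHolds` is needed: the row carries sturdiness. [cite: MochizukiCombGC2007, Prop 1.2 proof p.9] -/
theorem unrVerticialSeparating_unrLevels_of_origin (hres : RestrictBDOfPSCTypeHolds Ω)
    (hsplit : ∀ ⦃Q : Type u⦄ [Group Q] [TopologicalSpace Q] [IsTopologicalGroup Q] (G : PSCDatum Q),
      Ω.IsOfPSCType G → G.UnrVerticialSplitInjection')
    (hrank : UnrVertAbOfRankHolds Ω)
    (hprof : ∀ ⦃Q : Type u⦄ [Group Q] [TopologicalSpace Q] [IsTopologicalGroup Q] (G : PSCDatum Q),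
      Ω.IsOfPSCType G → CompactSpace Q ∧ TotallyDisconnectedSpace Q)
    {Q : Type u} [Group Q] [TopologicalSpace Q] [IsTopologicalGroup Q] (G : PSCDatum Q)
    (hG : Ω.IsOfPSCType G) :
    G.IsSturdy → ∀ V : Subgroup Q, V.Normal → IsOpen (V : Set Q) → G.unrKer ≤ V →
      ∃ V' : Subgroup Q, V'.Normal ∧ IsOpen (V' : Set Q) ∧ V' ≤ V ∧
        ∀ (v₁ v₂ : G.graph.V) (γ₁ γ₂ : ConjAct Q),
          (v₁ ≠ v₂ ∨
            DoubleCoset.doubleCoset (ConjAct.ofConjAct γ₁) (V' : Set Q)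
                ((G.vertGp v₁ ⊔ G.unrKer : Subgroup Q) : Set Q) ≠
              DoubleCoset.doubleCoset (ConjAct.ofConjAct γ₂) (V' : Set Q)
                ((G.vertGp v₂ ⊔ G.unrKer : Subgroup Q) : Set Q)) →
          ∃ U : Subgroup Q, IsOpen (U : Set Q) ∧ U ≤ V' ∧ (U.subgroupOf V').Normal ∧
            (γ₂ • G.vertGp v₂ ⊔ G.unrKer) ⊓ V' ≤ U ∧ ¬ ((γ₁ • G.vertGp v₁) ⊓ V' ≤ U) := by
  obtain ⟨hc, htd⟩ := hprof G hG
  haveI : T2Space Q := inferInstance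
  obtain ⟨bd, hbd⟩ := hres G hG
  exact G.unrVerticialSeparating_unrLevels_of_sturdy bd fun V _ hV _ _ =>
    ⟨hsplit _ (hbd V hV), hrank _ (hbd V hV)⟩

/-- The same from the named successor statement `UnrVerticialCharacterizationHolds' Ω` of F-1938.
[cite: MochizukiCombGC2007, Prop 1.2 proof p.9] -/
theorem unrVerticialSeparating_unrLevels_of_origin' (hres : RestrictBDOfPSCTypeHolds Ω)
    (hunr : UnrVerticialCharacterizationHolds' Ω) (hrank : UnrVertAbOfRankHolds Ω)
    (hprof : ∀ ⦃Q : Type u⦄ [Group Q] [TopologicalSpace Q] [IsTopologicalGroup Q] (G : PSCDatum Q),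
      Ω.IsOfPSCType G → CompactSpace Q ∧ TotallyDisconnectedSpace Q)
    {Q : Type u} [Group Q] [TopologicalSpace Q] [IsTopologicalGroup Q] (G : PSCDatum Q)
    (hG : Ω.IsOfPSCType G) :
    G.IsSturdy → ∀ V : Subgroup Q, V.Normal → IsOpen (V : Set Q) → G.unrKer ≤ V →
      ∃ V' : Subgroup Q, V'.Normal ∧ IsOpen (V' : Set Q) ∧ V' ≤ V ∧
        ∀ (v₁ v₂ : G.graph.V) (γ₁ γ₂ : ConjAct Q),
          (v₁ ≠ v₂ ∨
            DoubleCoset.doubleCoset (ConjAct.ofConjAct γ₁) (V' : Set Q)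
                ((G.vertGp v₁ ⊔ G.unrKer : Subgroup Q) : Set Q) ≠
              DoubleCoset.doubleCoset (ConjAct.ofConjAct γ₂) (V' : Set Q)
                ((G.vertGp v₂ ⊔ G.unrKer : Subgroup Q) : Set Q)) →
          ∃ U : Subgroup Q, IsOpen (U : Set Q) ∧ U ≤ V' ∧ (U.subgroupOf V').Normal ∧
            (γ₂ • G.vertGp v₂ ⊔ G.unrKer) ⊓ V' ≤ U ∧ ¬ ((γ₁ • G.vertGp v₁) ⊓ V' ≤ U) :=
  unrVerticialSeparating_unrLevels_of_origin Ω hres (fun _ _ _ _ G' hG' => (hunr G' hG').1) hrank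
    hprof G hG

/-- The same from the FROZEN `UnrVerticialCharacterizationHolds Ω` (row F-1938; it implies its
successor for every datum). [cite: MochizukiCombGC2007, Prop 1.2 proof p.9] -/
theorem unrVerticialSeparating_unrLevels_of_origin_frozen (hres : RestrictBDOfPSCTypeHolds Ω)
    (hunr : UnrVerticialCharacterizationHolds Ω) (hrank : UnrVertAbOfRankHolds Ω)
    (hprof : ∀ ⦃Q : Type u⦄ [Group Q] [TopologicalSpace Q] [IsTopologicalGroup Q] (G : PSCDatum Q),
      Ω.IsOfPSCType G → CompactSpace Q ∧ TotallyDisconnectedSpace Q)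
    {Q : Type u} [Group Q] [TopologicalSpace Q] [IsTopologicalGroup Q] (G : PSCDatum Q)
    (hG : Ω.IsOfPSCType G) :
    G.IsSturdy → ∀ V : Subgroup Q, V.Normal → IsOpen (V : Set Q) → G.unrKer ≤ V →
      ∃ V' : Subgroup Q, V'.Normal ∧ IsOpen (V' : Set Q) ∧ V' ≤ V ∧
        ∀ (v₁ v₂ : G.graph.V) (γ₁ γ₂ : ConjAct Q),
          (v₁ ≠ v₂ ∨
            DoubleCoset.doubleCoset (ConjAct.ofConjAct γ₁) (V' : Set Q)
                ((G.vertGp v₁ ⊔ G.unrKer : Subgroup Q) : Set Q) ≠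
              DoubleCoset.doubleCoset (ConjAct.ofConjAct γ₂) (V' : Set Q)
                ((G.vertGp v₂ ⊔ G.unrKer : Subgroup Q) : Set Q)) →
          ∃ U : Subgroup Q, IsOpen (U : Set Q) ∧ U ≤ V' ∧ (U.subgroupOf V').Normal ∧
            (γ₂ • G.vertGp v₂ ⊔ G.unrKer) ⊓ V' ≤ U ∧ ¬ ((γ₁ • G.vertGp v₁) ⊓ V' ≤ U) :=
  unrVerticialSeparating_unrLevels_of_origin' Ω hres hunr.toPrime hrank hprof G hG

end Origin

end PSCDatum

end Literature.AnabelianGeometry.SemiGraphs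

end
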